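import Summits.BirchSwinnertonDyer.BirchSwinnertonDyer.Theorems.EisensteinPrimesMazurMCOnCellBTwistbackOrderOnePartnerPAdicGZ
import Summits.BirchSwinnertonDyer.BirchSwinnertonDyer.Theorems.EisensteinPrimesMazurMCOnCellBTwistbackOnePartnerAt
import Summits.BirchSwinnertonDyer.BirchSwinnertonDyer.Theorems.EisensteinPrimesMazurMCOnCellBTwistbackZigzagClassData
import HarnessLib

/-!
# Crux 3 `MazurMCOnCellB` (stmt-BirchSwinnertonDyer-19033), line `twistback` v10 → v11 — ROAD (b) AS A CONNECTED ANCHOR: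
# Mazur's main conjecture at an X2b pair `(W, p)` whose class is joined by a zig-zag of certified two-steps to a NON-split
# X2b pair `W₀` carrying ONE admissible field `K₀` with the certificate `ord_{T=0} L_p(E₀^{(d_{K₀})}, T) = 1`

LEAD bsd-line-x2-p1 (gen 15), cell `bsd-eis`, 2026-08-28. `--supports stmt-BirchSwinnertonDyer-19033 --as helper`.
HONEST FRAMING: THEOREMS ONLY (no `def`, no named fact introduced, no `sorry`); closes no registered stub; every theorem is
CONDITIONAL on the named facts it lists — the route's `PublishedInputs` (item -19037), Disegni 2020 Thm. 4(1) and Thm. 2.4,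
Mazur 1978 Cor. 4.1, Hsieh 2014 Thm. 1, Liu–Zhang–Zhang 2018 (all PUBLISHED) and Keller–Yin 2024 Thm. D (PREPRINT, flag
KYD-gap) — i.e. EXACTLY the cone of the registered skeleton twistback v10 (stubs 1, 2, 3a); no summit statement, no Mazur
main conjecture and no case of BSD is proved for any curve; 0 cells / labels / stubs / tiers move.

## Why

The registered open stub 6⁵ `stub_upperPartnerOffSubrowNoConnectedClassShaUnit` of twistback v10 (LEAD g14, sha256
5c167aac…) excludes, besides the closed sub-row, exactly the X2b pairs whose isogeny class is CONNECTED (zig-zags of x2-p1-w6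
g3's certified two-step edges `TwoStepAt p`, p667979; relation of x2-p1-w3 g14's p671590) to a Ш-UNIT class — road (e), the
only per-pair exit inside the registered statement for a pair off the sub-row. Road (b) of the LEAD verdicts g9–g14 §2 (ii)
— at a NON-split X2b pair, ONE admissible `K` whose twist `E^{(d_K)}` has `ord_{T=0} L_p = 1` gives the ∃-PARTNER with
PUBLISHED inputs only (x2-p1-w3 g11, p661229 `…TwistbackOrderOnePartnerPAdicGZ` §1: Perrin-Riou's argument through Disegni's
`p`-adic Gross–Zagier formula at a non-split prime, then Disegni Thm. 4(1) under Greenberg–Vatsal) — has so far been a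
Theorems-side door only. This file makes it a CONNECTED ANCHOR like the Ш-unit class: `BSD_p` holds at the anchor `W₀`
(§1: the partner from p661229 §1, then x2-p1-w6 g2's per-pair core p663790 `bsdp_of_cellB_of_upper_partnerAt`, i.e. STEP L =
item -27489 in the rank-zero orientation ⟸ Keller–Yin Thm. D + Hsieh + LZZ + Poitou–Tate), travels to the start `W₁` of the
zig-zag by p671590 `bsdp_of_cellB_of_zigzag_of_bsdp`, to `W ∼ W₁` by Cassels, and the exact converse at a reducible
multiplicative rank-zero pair (`X2.mazurMainConjectureAt_of_bsdp_of_red`) gives Mazur's main conjecture at `(W, p)` (§2).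
The LEAD's v11 skeleton threads the negation of §2's datum as the fourth hypothesis of the registered open stub and feeds
§2 BY NAME on the new derived branch; nothing new is claimed class-wide (the supply «every non-split X2b component has an
order-one anchor» is Schneider's conjecture at one partner, OPEN).

## What

* §1 `bsdp_of_cellB_of_not_split_of_orderOne_twist` — `BSDp W₀ p` at a NON-split X2b pair from ONE admissible `K` with
  the order-one certificate at every minimal model of the twist (p661229 §1 + p663790 §1);
  `mazurMainConjectureAt_of_cellB_of_not_split_of_orderOne_twist` — the same with the exact converse (road (b) AT the pair,
  by name, in the skeleton's cone).
* §2 `mazurMainConjectureAt_of_cellB_of_connectedOrderOneAnchor` — at an X2b pair `(W, p)`: a curve `W₁ ∼ W`, a zig-zag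
  `W₁ ⇝ W₀` (the v10 inline relation VERBATIM), `(W₀, p)` non-split with an admissible `K₀` carrying the certificate ⟹
  `X2.MazurMainConjectureAt W p`; `bsdp_of_cellB_of_connectedOrderOneAnchor` the `BSDp` form.
* §3 `mazurMainConjectureAt_of_cellB_of_isIsogenous_orderOneAnchor` — the empty zig-zag (anchor in `W`'s own class).

References: [Disegni2020] §2.2 Thm. 2.4, §3.2 Thm. 4; [PerrinRiou1987] §1.4; [GreenbergVatsal2000] Thm. (1.3);
[KellerYin2024] Thm. D (= Thm. 5.1.3); [Wuthrich2014] Thm. 16; [MilneADT2006] Thm. I.7.3 (Cassels); [Miller2011LMS] Def. 1.1;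
tree: p661229, p663790, p671590, p674224 (`…ZigzagClassData.cellB_of_cellB_of_zigzag`).
-/

set_option autoImplicit false

-- `Summit.BirchSwinnertonDyer.BirchSwinnertonDyer.…`: the summit and its single sub-problem share a name.
set_option linter.dupNamespace false

noncomputable section

open scoped Classical MatrixGroups ModularForm

open CongruenceSubgroup WeierstrassCurve NumberField
  Literature.NumberTheory.EllipticCurves
  Literature.NumberTheory.GaloisRepresentations
  Literature.NumberTheory.EllipticCurves.ModularForms
  Literature.NumberTheory.QuadraticFields
  Literature.NumberTheory.EllipticCurves.Rank1Residual
  Literature.NumberTheory.EllipticCurves.Rank1Residual.Typed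
  Literature.NumberTheory.EllipticCurves.Wuthrich2014
  Literature.NumberTheory.EllipticCurves.Disegni2020
  Literature.NumberTheory.EllipticCurves.KellerYin2024
  Literature.NumberTheory.GaloisCohomology
  Summit.BirchSwinnertonDyer.Rank1Residual
  Summit.BirchSwinnertonDyer.Rank1Residual.X2
  Summit.BirchSwinnertonDyer.BirchSwinnertonDyer.Theses
  Summit.BirchSwinnertonDyer.BirchSwinnertonDyer.Theorems.EisensteinPrimesMazurMCOnCellBTwistbackTwoStepDefs

namespace Summit.BirchSwinnertonDyer.BirchSwinnertonDyer.Theorems.EisensteinPrimesMazurMCOnCellBTwistbackOrderOneAnchorZigzag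

/-! ## §1. Road (b) AT a non-split X2b pair, by name: `BSD_p` and the main conjecture from ONE order-one admissible twist -/

/-- **`BSD(E₀, p)` at a NON-split X2b pair from ONE admissible field whose twist carries the order-one certificate.** Data:
`X2.CellB W₀ p`, `p` non-split for `W₀`; `K` imaginary quadratic, Heegner for `N_{W₀}` and for `p`, `d_K` odd `< −4`; at
every globally minimal model `Wd` of `E₀^{(d_K)}`, for every newform `f` of `Wd`, every `ϖ` with `ϖ·Ω(Wd) = Ω⁺(f)` and every
non-split multiplicative `p`-adic `L`-function `L` of `f`: `ord_{T=0} L = 1` (`hordL`, VERBATIM p661229 §1). Then p661229 §1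
(`upperPartner_at_of_orderOne_partner_of_padicGZ`: `r_an(E₀^{(d_K)}) = 1` by Perrin-Riou + Disegni Thm. 2.4 + Hoffstein–Luo +
Gross–Zagier, upper half by Disegni Thm. 4(1) under Greenberg–Vatsal) gives the ∃-PARTNER at `(W₀, p)`, a globally minimal
model of the twist exists (`exists_isGloballyMinimal_smul_eq_quadraticTwist`), and x2-p1-w6 g2's per-pair core p663790
`bsdp_of_cellB_of_upper_partnerAt` (STEP L ⟸ Keller–Yin Thm. D, Poitou–Tate ×2, Hsieh, LZZ, Mazur Cor. 4.1) gives `BSDp W₀ p`.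
Named facts BY NAME; CONDITIONAL; nothing about any curve is proved unconditionally.
[claim: KellerYin2024, status: under-review] [cite: KellerYin2024, Thm. D = Thm. 5.1.3 (arXiv:2402.12781v2 L306–L309)]
[cite: Disegni2020, §2.2 Thm. 2.4 and §3.2 Thm. 4] [cite: PerrinRiou1987, §1.4 Cor. 1.8] [cite: Mazur1978, Cor. 4.1]
[cite: MilneADT2006, Thm. I.4.10 and Thm. I.7.3] [cite: Miller2011LMS, Def. 1.1] -/
theorem bsdp_of_cellB_of_not_split_of_orderOne_twist (hP : EisensteinPrimes.PublishedInputs)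
    (hPT : ∀ (K : Type) [Field K] [NumberField K], poitouTate_selmerStructure_duality K)
    (hPT2 : ∀ (K : Type) [Field K] [NumberField K], poitouTate_sha_tateDual K)
    (hH : hsieh2014_exists_anticyclotomicPAdicLFunction)
    (hF : LiuZhangZhang2018.thm151_thm153_modularCurve_heegnerVector) (hMaz : mazur_not_dvd_maninConstant_of_odd)
    (hDis : padicBSD_rankOne_nonsplitMult) (hDGZ : padicGrossZagier_nonsplitMult)
    (hD : KellerYin2024.thmD_imcMult_exists_isBDPLFunction_isTorsion_charIdeal_eq_OPEN)
    (W₀ : WeierstrassCurve ℚ) [W₀.IsElliptic] [W₀.IsGloballyMinimal] (p : ℕ) [Fact p.Prime]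
    (hc₀ : X2.CellB W₀ p) (hns₀ : ¬ W₀.HasSplitMultiplicativeReductionAtPrime p)
    (K : Type) [Field K] [NumberField K] (hK : IsImaginaryQuadratic K)
    (hHN : SatisfiesHeegnerHypothesis (W₀.conductorNorm ℤ) K) (hHp : SatisfiesHeegnerHypothesis p K)
    (hodd : Odd (NumberField.discr K)) (hlt : NumberField.discr K < -4)
    (hordL : ∀ (Wd : WeierstrassCurve ℚ) [Wd.IsElliptic] [Wd.IsGloballyMinimal],
      (∃ C : VariableChange ℚ, C • Wd = W₀.quadraticTwist (NumberField.discr K : ℚ)) →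
      ∀ {M : ℕ} [NeZero M] (f : CuspForm (Gamma0 M) 2), IsNewformOf Wd f →
      ∀ (ϖ : ℚ), (ϖ : ℝ) * Wd.realPeriodRat = plusPeriod f →
      ∀ L : PowerSeries ℚ_[p], IsMultPAdicLFunctionOf f p (-1) L → L.order = ((1 : ℕ) : ℕ∞)) :
    BSDp W₀ p := by
  obtain ⟨K', _, _, hK', hHN', hHp', hodd', hlt', hr1', hU'⟩ :=
    EisensteinPrimesMazurMCOnCellBTwistbackOrderOnePartnerPAdicGZ.upperPartner_at_of_orderOne_partner_of_padicGZ
      hP hDis hDGZ W₀ p hc₀ hns₀ K hK hHN hHp hodd hlt hordL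
  have hd0 : (NumberField.discr K' : ℚ) ≠ 0 := by exact_mod_cast NumberField.discr_ne_zero K'
  obtain ⟨Wd, _, _, C, hC⟩ := exists_isGloballyMinimal_smul_eq_quadraticTwist W₀ hd0
  exact EisensteinPrimesMazurMCOnCellBTwistbackOnePartnerAt.bsdp_of_cellB_of_upper_partnerAt hP hPT hPT2 hH hF hMaz hD
    W₀ p hc₀ K' hK' hHN' hHp' hodd' hlt' hr1' Wd ⟨C, hC⟩ (hU' Wd ⟨C, hC⟩)

/-- **Mazur's main conjecture at a NON-split X2b pair from ONE order-one admissible twist — road (b) AT the pair, by name,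
in the registered skeleton's cone**: `bsdp_of_cellB_of_not_split_of_orderOne_twist` and the exact converse at an odd
multiplicative reducible rank-`0` pair (`X2.mazurMainConjectureAt_of_bsdp_of_red`: Wuthrich Thm. 16, Stein–Wuthrich Thm. 6.1
and the canonical heights, Greenberg–Stevens, GZK, modularity — all conjuncts of `PublishedInputs`). Same statement as
p661229 §2 up to the STEP L input: there an `X11b.IndexLowerBoundAt`-datum hypothesis, here Keller–Yin Thm. D BY NAME
(the skeleton's `stub_thmD`). CONDITIONAL; a main conjecture is proved for no curve.
[claim: KellerYin2024, status: under-review] [cite: KellerYin2024, Thm. D = Thm. 5.1.3]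
[cite: Disegni2020, §2.2 Thm. 2.4 and §3.2 Thm. 4] [cite: Wuthrich2014, Thm. 16 and §5 (p. 397)]
[cite: GreenbergLNM1716, §4 (PDF pp. 112–113)] [cite: Miller2011LMS, Def. 1.1] -/
theorem mazurMainConjectureAt_of_cellB_of_not_split_of_orderOne_twist (hP : EisensteinPrimes.PublishedInputs)
    (hPT : ∀ (K : Type) [Field K] [NumberField K], poitouTate_selmerStructure_duality K)
    (hPT2 : ∀ (K : Type) [Field K] [NumberField K], poitouTate_sha_tateDual K)
    (hH : hsieh2014_exists_anticyclotomicPAdicLFunction)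
    (hF : LiuZhangZhang2018.thm151_thm153_modularCurve_heegnerVector) (hMaz : mazur_not_dvd_maninConstant_of_odd)
    (hDis : padicBSD_rankOne_nonsplitMult) (hDGZ : padicGrossZagier_nonsplitMult)
    (hD : KellerYin2024.thmD_imcMult_exists_isBDPLFunction_isTorsion_charIdeal_eq_OPEN)
    (W₀ : WeierstrassCurve ℚ) [W₀.IsElliptic] [W₀.IsGloballyMinimal] (p : ℕ) [Fact p.Prime]
    (hc₀ : X2.CellB W₀ p) (hns₀ : ¬ W₀.HasSplitMultiplicativeReductionAtPrime p)
    (K : Type) [Field K] [NumberField K] (hK : IsImaginaryQuadratic K)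
    (hHN : SatisfiesHeegnerHypothesis (W₀.conductorNorm ℤ) K) (hHp : SatisfiesHeegnerHypothesis p K)
    (hodd : Odd (NumberField.discr K)) (hlt : NumberField.discr K < -4)
    (hordL : ∀ (Wd : WeierstrassCurve ℚ) [Wd.IsElliptic] [Wd.IsGloballyMinimal],
      (∃ C : VariableChange ℚ, C • Wd = W₀.quadraticTwist (NumberField.discr K : ℚ)) →
      ∀ {M : ℕ} [NeZero M] (f : CuspForm (Gamma0 M) 2), IsNewformOf Wd f →
      ∀ (ϖ : ℚ), (ϖ : ℝ) * Wd.realPeriodRat = plusPeriod f →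
      ∀ L : PowerSeries ℚ_[p], IsMultPAdicLFunctionOf f p (-1) L → L.order = ((1 : ℕ) : ℕ∞)) :
    X2.MazurMainConjectureAt W₀ p := by
  have hnf := hP.2.2.2.2.2.1
  have hGZK := hP.2.2.2.2.2.2.2.2.2.2.1
  have hWu := hP.2.2.2.2.2.2.2.2.2.2.2.2.2.2.1
  have hJs := hP.2.2.2.2.2.2.2.2.2.2.2.2.2.2.2.1
  have hJn := hP.2.2.2.2.2.2.2.2.2.2.2.2.2.2.2.2.1
  have hHs := hP.2.2.2.2.2.2.2.2.2.2.2.2.2.2.2.2.2.1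
  have hHn := hP.2.2.2.2.2.2.2.2.2.2.2.2.2.2.2.2.2.2.1
  have hGS := hP.2.2.2.2.2.2.2.2.2.2.2.2.2.2.2.2.2.2.2
  have hE : WeierstrassCurve.hasEntireLFunction_rat :=
    WeierstrassCurve.hasEntireLFunction_rat_of_exists_isNewformOf hnf
  exact X2.mazurMainConjectureAt_of_bsdp_of_red hWu hJs hJn hHs hHn hGZK hE W₀ p (hGS W₀ p) hc₀.2.1.1 hc₀.2.1.2.2
    hc₀.2.1.2.1 hc₀.1
    (bsdp_of_cellB_of_not_split_of_orderOne_twist hP hPT hPT2 hH hF hMaz hDis hDGZ hD W₀ p hc₀ hns₀ K hK hHN hHp hodd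
      hlt hordL)

/-! ## §2. Road (b) as a CONNECTED anchor: `BSD_p` / the main conjecture at `(W, p)` from an order-one anchor joined to the
class of `W` by a zig-zag of certified two-steps -/

/-- **`BSD(E, p)` at an X2b pair CONNECTED to an ORDER-ONE ANCHOR.** Data at the X2b pair `(W, p)`: a globally minimal
`W₁ ∼ W` (ℚ-isogenous), a zig-zag `W₁ ⇝ W₀` — `Relation.ReflTransGen` of «`TwoStepAt p A B ∨ (TwoStepAt p B A ∧ (B, p) is
X2b)`», VERBATIM the relation of twistback v10's stub 6⁵ / p671590 —, the far end `(W₀, p)` NON-split, and ONE admissible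
`K₀` for `W₀` (Heegner for `N_{W₀}` and `p`, `d` odd `< −4`) with the order-one certificate at every minimal model of
`E₀^{(d_{K₀})}` (VERBATIM p661229 §1 `hordL`). Proof: `(W₁, p)` is X2b (`X2.cellB_iff_of_isIsogenous`, Tate uniformisation
DISCHARGED by `TateCurve.Silverman1994_thmV53_*_holds`), `(W₀, p)` is X2b (x2-p1-w3 g15's `cellB_of_cellB_of_zigzag`,
p674224), `BSDp W₀ p` (§1), `BSDp W₁ p` by x2-p1-w3 g14's zig-zag transport p671590 `bsdp_of_cellB_of_zigzag_of_bsdp`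
(backward along forward edges by x2-p1-w6 g3's chain door, forward along backward edges by the defect swap through STEP L),
`BSDp W p` by Cassels (`X2.bsdp_of_isIsogenous_of_bsdp`). Named facts BY NAME: `PublishedInputs`, Poitou–Tate ×2 (tree
theorems at the call site), Hsieh, LZZ, Mazur Cor. 4.1, Disegni Thm. 4(1), Disegni Thm. 2.4, Keller–Yin Thm. D (PRE) —
the v10 cone. CONDITIONAL; nothing about any curve is proved unconditionally; that every non-split X2b component HAS such
an anchor is NOT claimed (it is Schneider's conjecture at one partner, open).
[claim: KellerYin2024, status: under-review] [cite: KellerYin2024, Thm. D = Thm. 5.1.3 (arXiv:2402.12781v2 L306–L309)]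
[cite: Disegni2020, §2.2 Thm. 2.4 and §3.2 Thm. 4] [cite: MilneADT2006, Thm. I.7.3 (Cassels)]
[cite: LiuZhangZhang2018, Thms. 1.5.1 and 1.5.3] [cite: Miller2011LMS, Def. 1.1] -/
theorem bsdp_of_cellB_of_connectedOrderOneAnchor (hP : EisensteinPrimes.PublishedInputs)
    (hPT : ∀ (K : Type) [Field K] [NumberField K], poitouTate_selmerStructure_duality K)
    (hPT2 : ∀ (K : Type) [Field K] [NumberField K], poitouTate_sha_tateDual K)
    (hH : hsieh2014_exists_anticyclotomicPAdicLFunction)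
    (hF : LiuZhangZhang2018.thm151_thm153_modularCurve_heegnerVector) (hMaz : mazur_not_dvd_maninConstant_of_odd)
    (hDis : padicBSD_rankOne_nonsplitMult) (hDGZ : padicGrossZagier_nonsplitMult)
    (hD : KellerYin2024.thmD_imcMult_exists_isBDPLFunction_isTorsion_charIdeal_eq_OPEN)
    (W : WeierstrassCurve ℚ) [W.IsElliptic] [W.IsGloballyMinimal] (p : ℕ) [Fact p.Prime] (hc : X2.CellB W p)
    (hA : ∃ (W₁ : WeierstrassCurve ℚ) (_ : W₁.IsElliptic) (_ : W₁.IsGloballyMinimal)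
      (W₀ : WeierstrassCurve ℚ) (_ : W₀.IsElliptic) (_ : W₀.IsGloballyMinimal),
      IsIsogenous W W₁ ∧
      Relation.ReflTransGen (fun A B : WeierstrassCurve ℚ ↦ TwoStepAt p A B ∨
        (TwoStepAt p B A ∧ ∃ (_ : B.IsElliptic) (_ : B.IsGloballyMinimal), X2.CellB B p)) W₁ W₀ ∧
      ¬ W₀.HasSplitMultiplicativeReductionAtPrime p ∧
      ∃ (K : Type) (_ : Field K) (_ : NumberField K), IsImaginaryQuadratic K ∧
        SatisfiesHeegnerHypothesis (W₀.conductorNorm ℤ) K ∧ SatisfiesHeegnerHypothesis p K ∧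
        Odd (NumberField.discr K) ∧ NumberField.discr K < -4 ∧
        ∀ (Wd : WeierstrassCurve ℚ) [Wd.IsElliptic] [Wd.IsGloballyMinimal],
          (∃ C : VariableChange ℚ, C • Wd = W₀.quadraticTwist (NumberField.discr K : ℚ)) →
          ∀ {M : ℕ} [NeZero M] (f : CuspForm (Gamma0 M) 2), IsNewformOf Wd f →
          ∀ (ϖ : ℚ), (ϖ : ℝ) * Wd.realPeriodRat = plusPeriod f →
          ∀ L : PowerSeries ℚ_[p], IsMultPAdicLFunctionOf f p (-1) L → L.order = ((1 : ℕ) : ℕ∞)) :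
    BSDp W p := by
  have hCassels := hP.2.1
  have hnf := hP.2.2.2.2.2.1
  have hGZK := hP.2.2.2.2.2.2.2.2.2.2.1
  have hE : WeierstrassCurve.hasEntireLFunction_rat :=
    WeierstrassCurve.hasEntireLFunction_rat_of_exists_isNewformOf hnf
  obtain ⟨W₁, _, _, W₀, _, _, hiso, hz, hns₀, K, _, _, hK, hHN, hHp, hodd, hlt, hordL⟩ := hA
  have hc₁ : X2.CellB W₁ p :=
    (X2.cellB_iff_of_isIsogenous (p := p) TateCurve.Silverman1994_thmV53_tateUniformisation_holds
      TateCurve.Silverman1994_thmV53_corV54_tateUniformisation_holds hiso).mp hc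
  obtain ⟨_, _, hc₀⟩ :=
    EisensteinPrimesMazurMCOnCellBTwistbackZigzagClassData.cellB_of_cellB_of_zigzag hE hc₁ hz
  have hbsd₀ : BSDp W₀ p :=
    bsdp_of_cellB_of_not_split_of_orderOne_twist hP hPT hPT2 hH hF hMaz hDis hDGZ hD W₀ p hc₀ hns₀ K hK hHN hHp hodd
      hlt hordL
  have hbsd₁ : BSDp W₁ p :=
    EisensteinPrimesMazurMCOnCellBTwistbackDefectSwapZigzag.bsdp_of_cellB_of_zigzag_of_bsdp hP hMaz hH hF hD hc₁ hz
      hbsd₀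
  exact X2.bsdp_of_isIsogenous_of_bsdp hCassels hGZK hE W₁ W hiso.symm_of_charZero p (by rw [hc₁.1]; omega) hbsd₁

/-- **Mazur's main conjecture at an X2b pair CONNECTED to an ORDER-ONE ANCHOR** — `bsdp_of_cellB_of_connectedOrderOneAnchor`
and the exact converse at an odd multiplicative reducible rank-`0` pair (`X2.mazurMainConjectureAt_of_bsdp_of_red`; Wuthrich
Thm. 16, Stein–Wuthrich + canonical heights, Greenberg–Stevens, GZK, modularity from `PublishedInputs`). This is the theorem
the LEAD's twistback v11 feeds BY NAME on its new derived branch; its datum `hA` is, VERBATIM, the statement negated by the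
fourth hypothesis of the v11 registered stub. CONDITIONAL on the v10/v11 cone {`PublishedInputs`, (2a), (2c), (2f), (2g),
(2i′), Keller–Yin Thm. D}; a main conjecture is proved for no curve; the class-wide existence of anchors is NOT claimed.
[claim: KellerYin2024, status: under-review] [cite: KellerYin2024, Thm. D = Thm. 5.1.3]
[cite: Disegni2020, §2.2 Thm. 2.4 and §3.2 Thm. 4] [cite: Wuthrich2014, Thm. 16 and §5 (p. 397)]
[cite: GreenbergLNM1716, §4 (PDF pp. 112–113)] [cite: MilneADT2006, Thm. I.7.3] [cite: Miller2011LMS, Def. 1.1] -/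
theorem mazurMainConjectureAt_of_cellB_of_connectedOrderOneAnchor (hP : EisensteinPrimes.PublishedInputs)
    (hPT : ∀ (K : Type) [Field K] [NumberField K], poitouTate_selmerStructure_duality K)
    (hPT2 : ∀ (K : Type) [Field K] [NumberField K], poitouTate_sha_tateDual K)
    (hH : hsieh2014_exists_anticyclotomicPAdicLFunction)
    (hF : LiuZhangZhang2018.thm151_thm153_modularCurve_heegnerVector) (hMaz : mazur_not_dvd_maninConstant_of_odd)
    (hDis : padicBSD_rankOne_nonsplitMult) (hDGZ : padicGrossZagier_nonsplitMult)
    (hD : KellerYin2024.thmD_imcMult_exists_isBDPLFunction_isTorsion_charIdeal_eq_OPEN)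
    (W : WeierstrassCurve ℚ) [W.IsElliptic] [W.IsGloballyMinimal] (p : ℕ) [Fact p.Prime] (hc : X2.CellB W p)
    (hA : ∃ (W₁ : WeierstrassCurve ℚ) (_ : W₁.IsElliptic) (_ : W₁.IsGloballyMinimal)
      (W₀ : WeierstrassCurve ℚ) (_ : W₀.IsElliptic) (_ : W₀.IsGloballyMinimal),
      IsIsogenous W W₁ ∧
      Relation.ReflTransGen (fun A B : WeierstrassCurve ℚ ↦ TwoStepAt p A B ∨
        (TwoStepAt p B A ∧ ∃ (_ : B.IsElliptic) (_ : B.IsGloballyMinimal), X2.CellB B p)) W₁ W₀ ∧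
      ¬ W₀.HasSplitMultiplicativeReductionAtPrime p ∧
      ∃ (K : Type) (_ : Field K) (_ : NumberField K), IsImaginaryQuadratic K ∧
        SatisfiesHeegnerHypothesis (W₀.conductorNorm ℤ) K ∧ SatisfiesHeegnerHypothesis p K ∧
        Odd (NumberField.discr K) ∧ NumberField.discr K < -4 ∧
        ∀ (Wd : WeierstrassCurve ℚ) [Wd.IsElliptic] [Wd.IsGloballyMinimal],
          (∃ C : VariableChange ℚ, C • Wd = W₀.quadraticTwist (NumberField.discr K : ℚ)) →
          ∀ {M : ℕ} [NeZero M] (f : CuspForm (Gamma0 M) 2), IsNewformOf Wd f →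
          ∀ (ϖ : ℚ), (ϖ : ℝ) * Wd.realPeriodRat = plusPeriod f →
          ∀ L : PowerSeries ℚ_[p], IsMultPAdicLFunctionOf f p (-1) L → L.order = ((1 : ℕ) : ℕ∞)) :
    X2.MazurMainConjectureAt W p := by
  have hnf := hP.2.2.2.2.2.1
  have hGZK := hP.2.2.2.2.2.2.2.2.2.2.1
  have hWu := hP.2.2.2.2.2.2.2.2.2.2.2.2.2.2.1
  have hJs := hP.2.2.2.2.2.2.2.2.2.2.2.2.2.2.2.1
  have hJn := hP.2.2.2.2.2.2.2.2.2.2.2.2.2.2.2.2.1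
  have hHs := hP.2.2.2.2.2.2.2.2.2.2.2.2.2.2.2.2.2.1
  have hHn := hP.2.2.2.2.2.2.2.2.2.2.2.2.2.2.2.2.2.2.1
  have hGS := hP.2.2.2.2.2.2.2.2.2.2.2.2.2.2.2.2.2.2.2
  have hE : WeierstrassCurve.hasEntireLFunction_rat :=
    WeierstrassCurve.hasEntireLFunction_rat_of_exists_isNewformOf hnf
  exact X2.mazurMainConjectureAt_of_bsdp_of_red hWu hJs hJn hHs hHn hGZK hE W p (hGS W p) hc.2.1.1 hc.2.1.2.2
    hc.2.1.2.1 hc.1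
    (bsdp_of_cellB_of_connectedOrderOneAnchor hP hPT hPT2 hH hF hMaz hDis hDGZ hD W p hc hA)

/-! ## §3. The empty zig-zag: an order-one anchor in `W`'s own isogeny class -/

/-- **Mazur's main conjecture at an X2b pair whose own `ℚ`-isogeny class contains an ORDER-ONE ANCHOR** (the empty zig-zag
of §2: `W₁ := W₀ ∼ W`, `Relation.ReflTransGen.refl`): at `(W, p)` X2b, a globally minimal `W₀ ∼ W`, `p` non-split for
`W₀`, ONE admissible `K₀` for `W₀` with the order-one certificate ⟹ `X2.MazurMainConjectureAt W p`. With `W₀ := W` this is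
§1 up to Cassels. Same named facts; CONDITIONAL; nothing about any curve is proved unconditionally.
[claim: KellerYin2024, status: under-review] [cite: KellerYin2024, Thm. D = Thm. 5.1.3]
[cite: Disegni2020, §2.2 Thm. 2.4 and §3.2 Thm. 4] [cite: MilneADT2006, Thm. I.7.3] [cite: Miller2011LMS, Def. 1.1] -/
theorem mazurMainConjectureAt_of_cellB_of_isIsogenous_orderOneAnchor (hP : EisensteinPrimes.PublishedInputs)
    (hPT : ∀ (K : Type) [Field K] [NumberField K], poitouTate_selmerStructure_duality K)
    (hPT2 : ∀ (K : Type) [Field K] [NumberField K], poitouTate_sha_tateDual K)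
    (hH : hsieh2014_exists_anticyclotomicPAdicLFunction)
    (hF : LiuZhangZhang2018.thm151_thm153_modularCurve_heegnerVector) (hMaz : mazur_not_dvd_maninConstant_of_odd)
    (hDis : padicBSD_rankOne_nonsplitMult) (hDGZ : padicGrossZagier_nonsplitMult)
    (hD : KellerYin2024.thmD_imcMult_exists_isBDPLFunction_isTorsion_charIdeal_eq_OPEN)
    (W : WeierstrassCurve ℚ) [W.IsElliptic] [W.IsGloballyMinimal] (p : ℕ) [Fact p.Prime] (hc : X2.CellB W p)
    (W₀ : WeierstrassCurve ℚ) [W₀.IsElliptic] [W₀.IsGloballyMinimal] (hiso : IsIsogenous W W₀)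
    (hns₀ : ¬ W₀.HasSplitMultiplicativeReductionAtPrime p)
    (K : Type) [Field K] [NumberField K] (hK : IsImaginaryQuadratic K)
    (hHN : SatisfiesHeegnerHypothesis (W₀.conductorNorm ℤ) K) (hHp : SatisfiesHeegnerHypothesis p K)
    (hodd : Odd (NumberField.discr K)) (hlt : NumberField.discr K < -4)
    (hordL : ∀ (Wd : WeierstrassCurve ℚ) [Wd.IsElliptic] [Wd.IsGloballyMinimal],
      (∃ C : VariableChange ℚ, C • Wd = W₀.quadraticTwist (NumberField.discr K : ℚ)) →
      ∀ {M : ℕ} [NeZero M] (f : CuspForm (Gamma0 M) 2), IsNewformOf Wd f →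
      ∀ (ϖ : ℚ), (ϖ : ℝ) * Wd.realPeriodRat = plusPeriod f →
      ∀ L : PowerSeries ℚ_[p], IsMultPAdicLFunctionOf f p (-1) L → L.order = ((1 : ℕ) : ℕ∞)) :
    X2.MazurMainConjectureAt W p :=
  mazurMainConjectureAt_of_cellB_of_connectedOrderOneAnchor hP hPT hPT2 hH hF hMaz hDis hDGZ hD W p hc
    ⟨W₀, inferInstance, inferInstance, W₀, inferInstance, inferInstance, hiso, Relation.ReflTransGen.refl, hns₀,
      K, inferInstance, inferInstance, hK, hHN, hHp, hodd, hlt, fun Wd _ _ hWd ↦ hordL Wd hWd⟩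

end Summit.BirchSwinnertonDyer.BirchSwinnertonDyer.Theorems.EisensteinPrimesMazurMCOnCellBTwistbackOrderOneAnchorZigzag

end
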